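import Literature.IUT.HodgeTheaters.PiAvatarNegCompatLabels

/-!
# [IUTchI] Ex 6.3 (ii), negative case, at the GENUINE initial Θ-data — the inputs of the law (β) at an ARBITRARY embedded local
# object, and at the BAD places in the shape of record (proof-only; β-engine, bad-place half)

S. Mochizuki, *Inter-universal Teichmüller theory I*, kurims manuscript (May 2020), Example 6.3 (i) p. 160–161 ("`φ^{Θell}_{v̲}`
… the natural composite … `X̲̲_v̲ → X̲_v̲ → X̲_K` if `v̲ ∈ 𝕍^bad`"; the fixed chart `LabCusp^±(𝒟^{⊚±}) ⥲ 𝔽_l`), (ii) p. 161 ("one verifies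
immediately that `φ^{Θell}_±` is equivariant", NEGATIVE case), Def 6.1 (iii) p. 156–157 (`Aut_−(†𝒟_v̲)`, negative automorphisms),
(v) p. 158 (`Aut_±(𝒟^{⊚±})`, "contains the subgroup `Aut_K(X̲_K)`"), Def 3.1 (e) p. 62–63 / Ex 3.2 (i) p. 69 (at `v̲ ∈ 𝕍^bad`:
`𝒟_v̲ := ℬ^temp(X̲̲_v̲)⁰`, the covering `X̲̲_v̲ → X̲_v̲ → C̲_v̲` "determined by the theta structure", [EtTh] Def 2.5) ([IUTchI] Ex 6.3 (ii)
p.161) [claim: Mochizuki2012, status: disputed] (D-0012 claim key, series status DISPUTED; nothing of the series is asserted; no side is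
taken on [IUTchIII] Cor. 3.12).

β-ENGINE, bad-place half (abc-iut-L5-t13 lineage; reductions p420660 `negCompatModel_iff_commutes`, p423891
`Ex63.negCompatModel_of_fixes`; genuine data at GOOD places p428568 `exists_negCompat_good_mem`, p430566 `exists_negCompat_good_labels`).
Over abc-iut-L5-t4's binding (p423760: ONE ambient `OrbitCat Π_{C_F}`, `𝒟^{⊚±} = OrbitCat.of Π_{X̲_K}`; p425994 `toFlStarGlobal`;
`PiAvatarGlobalCuspLabels`: label action `gLabAutOfPiCund` (K2), chart `gChart₀Model` based at `ε⁰` (K1)) this PROOF-ONLY file records: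

* **`InitialThetaData.negCompat_inputs_of_mem_normalizer`** (MASTER LEMMA, no labels) and
  **`InitialThetaData.negCompat_labels_of_mem_normalizer`** (labels included) — for ANY embedded object `ℬ(H)⁰`, `H ≤ Π_{X̲_K}`, with
  arrow `(xH ↦ xΠ_{X̲_K}) : ℬ(H)⁰ → 𝒟^{⊚±}`, and ANY element `c ∈ Π_{C̲_K} ∖ Π_{X̲_K}` NORMALISING `H`: the square
  `(xH ↦ xcH) ≫ (xH ↦ xΠ_{X̲_K}) = (xH ↦ xΠ_{X̲_K}) ≫ (xΠ_{X̲_K} ↦ xcΠ_{X̲_K})` (abc-iut-L5-t13 `OrbitCat.autOfNormalizer_comp_incl`,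
  p421603), `toFlStarGlobal (xΠ_{X̲_K} ↦ xcΠ_{X̲_K}) = 1` (p428568), and on `GLab 𝒟^{⊚±} = Cusp(X̲_K)` the action of `c` FIXES
  `gChart₀⁻¹ 0 = ε⁰`, reads `x ↦ −x` in `gChart₀`, and is `≠ 1` (p430566's lemmas) — i.e. the COMPLETE hypothesis tuple of
  `Ex63.negCompatModel_of_fixes` at the object `ℬ(H)⁰`.  The good-place theorem p430566 is the instance `H := Π_v̲ = Π_{X̲→_K} ∩ augGF⁻¹ G_v̲`
  (its proof, verbatim); the bad places are the instance below.  One lemma feeds (β) at every `v̲ ∈ 𝕍`.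
* **`InitialThetaData.exists_negCompat_bad_mem`** / **`InitialThetaData.exists_negCompat_bad_labels`** — at a BAD place in the SHAPE OF
  RECORD of abc-iut-L5-lead RULINGS #36 (4) / GAP D-G-L5t4g3-2 (05:58:51Z): a pair `H ≤ H′` of subgroups of `Π_{C_F}` with `[H′ : H] = 2`,
  `H′ ≤ Π_{C̲_K}`, `H′ ∩ Π_{X̲_K} ≤ H` (the profinite images of `Π^temp_{X̲̲_v̲} ≤ Π^temp_{C̲_v̲}` read in `Π_{C_F}`, Def 3.1 (e) / Ex 3.2 (i);
  interface DATA, typed by the kit binder, not constructed here) — SOME `c ∈ H′ ∖ H` lies in `Π_{C̲_K} ∖ Π_{X̲_K}`, normalises `H`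
  (index two), induces on `ℬ(H)⁰` a NON-TRIVIAL INVOLUTION (the deck transformation `ι_v̲` of `X̲̲_v̲ → C̲_v̲` restricted, Def 6.1 (iii):
  a negative automorphism), and satisfies the master lemma's conclusions.  NO theta-function input, NO §1 claim `hA`, NO datum beyond
  the binder pair: the bad-place hypothesis of `Ex63.negCompatModel_of_fixes` for the genuine kit is discharged the moment the kit
  record binds its bad-place slots in this shape (kit packaging = abc-iut-L5-t4 lineage; nothing is claimed about the kit record itself;
  NODE RULE: the §6 law rows stay HELD:instance until (β) is a theorem OF that record).

Proof-only (no definitions, no `Prop` facts); typed ≠ proved elsewhere.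
-/

namespace Literature.IUT.HodgeTheaters

open CategoryTheory

universe u v w

section Bad

variable {F : Type u} {K : Type v} {Fbar : Type w} [Field F] [NumberField F] [Field K]
  [NumberField K] [Algebra F K] [Field Fbar] [Algebra F Fbar] [Algebra K Fbar]
  {E : WeierstrassCurve F} [E.IsElliptic] {l : ℕ} {P : BadPlacePredicates K}
  (D : InitialThetaData F K Fbar E l P)

namespace InitialThetaData

/-! ### The master lemma: one element of `Π_{C̲_K} ∖ Π_{X̲_K}` normalising the local subgroup gives every (β)-input -/

/-- **(β)-inputs at an arbitrary embedded local object, without labels** ([IUTchI] Ex 6.3 (ii) p.161, negative case): for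
`H ≤ Π_{X̲_K}` and `c ∈ Π_{C̲_K}` normalising `H`, the square `(xH ↦ xcH) ≫ (xH ↦ xΠ_{X̲_K}) = (xH ↦ xΠ_{X̲_K}) ≫ (xΠ_{X̲_K} ↦ xcΠ_{X̲_K})`
commutes on the nose and the global automorphism lies in `Aut_±(𝒟^{⊚±})` (`toFlStarGlobal = 1`, Def 6.1 (v) "`Aut_± … contains
Aut_K(X̲_K)`"). ([IUTchI] Ex 6.3 (ii) p.161) [claim: Mochizuki2012, status: disputed] -/
theorem negCompat_inputs_of_mem_normalizer [Fact l.Prime] [(D.PiXund.subgroupOf D.PiXK).Normal]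
    {H : Subgroup D.PiC} (hH : H ≤ D.PiXund) {c : D.PiC} (hc : c ∈ D.PiCund)
    (hcv : c ∈ Subgroup.normalizer ((H : Subgroup D.PiC) : Set D.PiC)) :
    ∃ (hcK : c ∈ Subgroup.normalizer ((D.PiXund : Subgroup D.PiC) : Set D.PiC)),
      (OrbitCat.autOfNormalizer c hcv).hom ≫ OrbitCat.homOfElem 1 (OrbitCat.one_conj_mem_of_le hH) =
          OrbitCat.homOfElem 1 (OrbitCat.one_conj_mem_of_le hH) ≫ (OrbitCat.autOfNormalizer c hcK).hom ∧
      D.toFlStarGlobal (OrbitCat.autOfNormalizer c hcK) = 1 :=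
  ⟨D.piCund_le_normalizer_piXund hc, OrbitCat.autOfNormalizer_comp_incl hH hcv _,
    D.toFlStarGlobal_autOfNormalizer_eq_one_of_mem_PiCund hc _⟩

variable (CG : D.geom.pe.CuspGalois)

/-- **(β)-inputs at an arbitrary embedded local object, labels included** ([IUTchI] Ex 6.3 (ii) p.161 with Def 6.1 (iii)/(v)):
for `H ≤ Π_{X̲_K}` and `c ∈ Π_{C̲_K} ∖ Π_{X̲_K}` normalising `H`: the square at `ℬ(H)⁰`, `toFlStarGlobal = 1`, and on the `±`-label
classes `GLab 𝒟^{⊚±} = Cusp(X̲_K)` the action of `c` FIXES the zero-cusp class `gChart₀⁻¹ 0 = ε⁰`, reads `x ↦ −x` in the chart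
`gChart₀` (so it is a lift of `(0,−1) ∈ 𝔽_l^{⋊±}`, `Ex63.mem_lifts_iff_gChart₀`), and is `≠ 1` — the complete hypothesis tuple of
`Ex63.negCompatModel_of_fixes` at this object.  The good places (p430566) are the instance `H := Π_{X̲→_K} ∩ augGF⁻¹ G_v̲`.
([IUTchI] Ex 6.3 (ii) p.161) [claim: Mochizuki2012, status: disputed] -/
theorem negCompat_labels_of_mem_normalizer [Fact l.Prime] [(D.PiXund.subgroupOf D.PiXK).Normal]
    {H : Subgroup D.PiC} (hH : H ≤ D.PiXund) {c : D.PiC} (hc : c ∈ D.PiCund) (hcX : c ∉ D.PiXund)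
    (hcv : c ∈ Subgroup.normalizer ((H : Subgroup D.PiC) : Set D.PiC)) :
    ∃ (hcK : c ∈ Subgroup.normalizer ((D.PiXund : Subgroup D.PiC) : Set D.PiC)),
      (OrbitCat.autOfNormalizer c hcv).hom ≫ OrbitCat.homOfElem 1 (OrbitCat.one_conj_mem_of_le hH) =
          OrbitCat.homOfElem 1 (OrbitCat.one_conj_mem_of_le hH) ≫ (OrbitCat.autOfNormalizer c hcK).hom ∧
      D.toFlStarGlobal (OrbitCat.autOfNormalizer c hcK) = 1 ∧
      D.gLabAutOfPiCund CG c hc ((D.gChart₀Model CG).symm 0) = (D.gChart₀Model CG).symm 0 ∧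
      (∀ x, D.gChart₀Model CG (D.gLabAutOfPiCund CG c hc x) = -D.gChart₀Model CG x) ∧
      D.gLabAutOfPiCund CG c hc ≠ 1 := by
  obtain ⟨hcK, hsq, hfl⟩ := D.negCompat_inputs_of_mem_normalizer hH hc hcv
  refine ⟨hcK, hsq, hfl, ?_, fun x => D.gChart₀Model_gLabAut_of_not_mem_PiXund CG c hc hcX x,
    D.gLabAutOfPiCund_ne_one_of_not_mem_PiXund CG c hc hcX⟩
  rw [D.gChart₀Model_symm_zero CG]
  exact D.gLabAutOfPiCund_ε0 CG c hc

/-! ### The bad places in the shape of record: a pair `H ≤ H′ ≤ Π_{C̲_K}`, `[H′ : H] = 2`, `H′ ∩ Π_{X̲_K} ≤ H` -/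

/-- In the shape of record the local subgroup lies in `Π_{X̲_K}`: if `H = H′ ∩ Π_{X̲_K}` then `H ≤ Π_{X̲_K}` (so that
`φ^{Θell}_{•,v̲} = (xH ↦ xΠ_{X̲_K})` is defined; [IUTchI] Def 3.1 (e) p.63: `X̲̲_v̲ → X̲_v̲` lies over `X̲_K`).
([IUTchI] Def 3.1 (e) p.63) [claim: Mochizuki2012, status: disputed] -/
theorem le_PiXund_of_inf_eq {H H' : Subgroup D.PiC} (hinf : H' ⊓ D.PiXund = H) : H ≤ D.PiXund :=
  hinf ▸ inf_le_right

/-- **The bad-place element.** For a pair `H ≤ H′` with `[H′ : H] = 2`, `H′ ≤ Π_{C̲_K}` and `H′ ∩ Π_{X̲_K} ≤ H` (the images of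
`Π^temp_{X̲̲_v̲} ≤ Π^temp_{C̲_v̲}` in `Π_{C_F}`, [IUTchI] Def 3.1 (e) p.63 / Ex 3.2 (i) p.69), some `c ∈ H′ ∖ H` lies in `Π_{C̲_K} ∖ Π_{X̲_K}`,
normalises `H`, and has `c·c ∈ H` — the deck transformation `ι_v̲` of the double covering at `v̲`. ([IUTchI] Ex 3.2 (i) p.69)
[claim: Mochizuki2012, status: disputed] -/
theorem exists_bad_involution_mem {H H' : Subgroup D.PiC} (hle : H ≤ H') (h2 : H.relIndex H' = 2)
    (hH' : H' ≤ D.PiCund) (hinf : H' ⊓ D.PiXund ≤ H) :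
    ∃ c : D.PiC, c ∈ H' ∧ c ∉ H ∧ c ∈ D.PiCund ∧ c ∉ D.PiXund ∧
      c ∈ Subgroup.normalizer ((H : Subgroup D.PiC) : Set D.PiC) ∧ c * c ∈ H := by
  obtain ⟨c, hcH', hcH, -⟩ := Subgroup.relIndex_eq_two_iff_exists_notMem_and.mp h2
  have hcc : c * c ∈ H := by
    have h' := (Subgroup.mul_mem_iff_of_index_two h2 (a := ⟨c, hcH'⟩) (b := ⟨c, hcH'⟩)).2 Iff.rfl
    exact Subgroup.mem_subgroupOf.mp h'
  exact ⟨c, hcH', hcH, hH' hcH', fun hX => hcH (hinf ⟨hcH', hX⟩),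
    OrbitCat.le_normalizer_of_relIndex_eq_two hle h2 hcH', hcc⟩

/-- **Ex 6.3 (ii), negative square at a BAD place of the genuine data, element exported (no labels)** ([IUTchI] Ex 6.3 (ii) p.161
with Ex 3.2 (i) p.69): in the shape of record (`H ≤ H′ ≤ Π_{C̲_K}`, `[H′ : H] = 2`, `H′ ∩ Π_{X̲_K} ≤ H`, `H ≤ Π_{X̲_K}`) there is
`c ∈ Π_{C̲_K} ∖ Π_{X̲_K}` normalising `H` and `Π_{X̲_K}` such that `a := (xH ↦ xcH)` is a NON-TRIVIAL INVOLUTION of `𝒟_v̲ = ℬ(H)⁰`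
(a negative automorphism, Def 6.1 (iii)), `b := (xΠ_{X̲_K} ↦ xcΠ_{X̲_K})` satisfies `a ≫ φ^{Θell}_{•,v̲} = φ^{Θell}_{•,v̲} ≫ b` for
`φ^{Θell}_{•,v̲} = (xH ↦ xΠ_{X̲_K})`, and `toFlStarGlobal b = 1`.  No theta input, no §1 claim.
([IUTchI] Ex 6.3 (ii) p.161) [claim: Mochizuki2012, status: disputed] -/
theorem exists_negCompat_bad_mem [Fact l.Prime] [(D.PiXund.subgroupOf D.PiXK).Normal]
    {H H' : Subgroup D.PiC} (hle : H ≤ H') (h2 : H.relIndex H' = 2) (hH' : H' ≤ D.PiCund)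
    (hinf : H' ⊓ D.PiXund ≤ H) (hH : H ≤ D.PiXund) :
    ∃ (c : D.PiC), c ∈ H' ∧ c ∉ H ∧ c ∈ D.PiCund ∧ c ∉ D.PiXund ∧
      ∃ (hcv : c ∈ Subgroup.normalizer ((H : Subgroup D.PiC) : Set D.PiC))
        (hcK : c ∈ Subgroup.normalizer ((D.PiXund : Subgroup D.PiC) : Set D.PiC)),
      OrbitCat.autOfNormalizer c hcv ≠ Iso.refl _ ∧
      OrbitCat.autOfNormalizer c hcv ≪≫ OrbitCat.autOfNormalizer c hcv = Iso.refl _ ∧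
      (OrbitCat.autOfNormalizer c hcv).hom ≫ OrbitCat.homOfElem 1 (OrbitCat.one_conj_mem_of_le hH) =
          OrbitCat.homOfElem 1 (OrbitCat.one_conj_mem_of_le hH) ≫ (OrbitCat.autOfNormalizer c hcK).hom ∧
      D.toFlStarGlobal (OrbitCat.autOfNormalizer c hcK) = 1 := by
  obtain ⟨c, hcH', hcH, hcCund, hcU, hcv, hcc⟩ := D.exists_bad_involution_mem hle h2 hH' hinf
  obtain ⟨hcK, hsq, hfl⟩ := D.negCompat_inputs_of_mem_normalizer hH hcCund hcv
  refine ⟨c, hcH', hcH, hcCund, hcU, hcv, hcK, fun h => hcH ((OrbitCat.autOfNormalizer_eq_refl_iff hcv).1 h), ?_,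
    hsq, hfl⟩
  rw [OrbitCat.autOfNormalizer_trans, OrbitCat.autOfNormalizer_eq_refl_iff]
  exact hcc

/-- **Ex 6.3 (ii), negative case, at a BAD place of the genuine data — ALL inputs of the law (β), labels included**
([IUTchI] Ex 6.3 (ii) p.161 with Ex 3.2 (i) p.69, Def 6.1 (iii)/(v) pp.156–158): in the shape of record there is
`c ∈ H′ ∖ H`, `c ∈ Π_{C̲_K} ∖ Π_{X̲_K}`, with `a := (xH ↦ xcH)` a non-trivial involution of `𝒟_v̲ = ℬ(H)⁰`, the square
`a ≫ φ^{Θell}_{•,v̲} = φ^{Θell}_{•,v̲} ≫ b` for `b := (xΠ_{X̲_K} ↦ xcΠ_{X̲_K})`, `toFlStarGlobal b = 1` (`b ∈ Aut_±(𝒟^{⊚±})`), and on the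
labels: `b` FIXES `gChart₀⁻¹ 0 = ε⁰`, reads `x ↦ −x` in `gChart₀`, and is `≠ 1` — literally the bad-place hypothesis of
`Ex63.negCompatModel_of_fixes` read through (K1)/(K2).  No theta input, no §1 claim. ([IUTchI] Ex 6.3 (ii) p.161)
[claim: Mochizuki2012, status: disputed] -/
theorem exists_negCompat_bad_labels [Fact l.Prime] [(D.PiXund.subgroupOf D.PiXK).Normal]
    {H H' : Subgroup D.PiC} (hle : H ≤ H') (h2 : H.relIndex H' = 2) (hH' : H' ≤ D.PiCund)
    (hinf : H' ⊓ D.PiXund ≤ H) (hH : H ≤ D.PiXund) :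
    ∃ (c : D.PiC) (hc : c ∈ D.PiCund), c ∈ H' ∧ c ∉ H ∧ c ∉ D.PiXund ∧
      ∃ (hcv : c ∈ Subgroup.normalizer ((H : Subgroup D.PiC) : Set D.PiC))
        (hcK : c ∈ Subgroup.normalizer ((D.PiXund : Subgroup D.PiC) : Set D.PiC)),
      OrbitCat.autOfNormalizer c hcv ≠ Iso.refl _ ∧
      OrbitCat.autOfNormalizer c hcv ≪≫ OrbitCat.autOfNormalizer c hcv = Iso.refl _ ∧
      (OrbitCat.autOfNormalizer c hcv).hom ≫ OrbitCat.homOfElem 1 (OrbitCat.one_conj_mem_of_le hH) =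
          OrbitCat.homOfElem 1 (OrbitCat.one_conj_mem_of_le hH) ≫ (OrbitCat.autOfNormalizer c hcK).hom ∧
      D.toFlStarGlobal (OrbitCat.autOfNormalizer c hcK) = 1 ∧
      D.gLabAutOfPiCund CG c hc ((D.gChart₀Model CG).symm 0) = (D.gChart₀Model CG).symm 0 ∧
      (∀ x, D.gChart₀Model CG (D.gLabAutOfPiCund CG c hc x) = -D.gChart₀Model CG x) ∧
      D.gLabAutOfPiCund CG c hc ≠ 1 := by
  obtain ⟨c, hcH', hcH, hcCund, hcU, hcv, hcK, hne, hinv, hsq, hfl⟩ := D.exists_negCompat_bad_mem hle h2 hH' hinf hH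
  obtain ⟨-, -, -, hfix, hneg, hne1⟩ := D.negCompat_labels_of_mem_normalizer CG hH hcCund hcU hcv
  exact ⟨c, hcCund, hcH', hcH, hcU, hcv, hcK, hne, hinv, hsq, hfl, hfix, hneg, hne1⟩

/-- The global automorphism at a bad place IS, on labels, the `(0,−1)` permutation in the chart — the right-hand side of
`Ex63.lifts K (FlPM.mk 0 (−1))` read through (K1)/(K2) (p430566 `gLabAutOfPiCund_eq_chart_conj_negOne`, which needs only
`c ∈ Π_{C̲_K} ∖ Π_{X̲_K}`; recorded here in the bad-place shape for the kit binder). ([IUTchI] Ex 6.3 (i) p.161)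
[claim: Mochizuki2012, status: disputed] -/
theorem exists_negCompat_bad_chart [Fact l.Prime] [(D.PiXund.subgroupOf D.PiXK).Normal]
    {H H' : Subgroup D.PiC} (hle : H ≤ H') (h2 : H.relIndex H' = 2) (hH' : H' ≤ D.PiCund)
    (hinf : H' ⊓ D.PiXund ≤ H) (hH : H ≤ D.PiXund) :
    ∃ (c : D.PiC) (hc : c ∈ D.PiCund),
      ∃ (hcv : c ∈ Subgroup.normalizer ((H : Subgroup D.PiC) : Set D.PiC))
        (hcK : c ∈ Subgroup.normalizer ((D.PiXund : Subgroup D.PiC) : Set D.PiC)),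
      (OrbitCat.autOfNormalizer c hcv).hom ≫ OrbitCat.homOfElem 1 (OrbitCat.one_conj_mem_of_le hH) =
          OrbitCat.homOfElem 1 (OrbitCat.one_conj_mem_of_le hH) ≫ (OrbitCat.autOfNormalizer c hcK).hom ∧
      D.toFlStarGlobal (OrbitCat.autOfNormalizer c hcK) = 1 ∧
      (D.gLabAutOfPiCund CG c hc : D.geom.pe.Cusp ≃ D.geom.pe.Cusp) =
        (D.gChart₀Model CG).trans ((FlPM.toPerm l (FlPM.mk 0 (-1))).trans (D.gChart₀Model CG).symm) := by
  obtain ⟨c, -, -, hcCund, hcU, hcv, hcK, -, -, hsq, hfl⟩ := D.exists_negCompat_bad_mem hle h2 hH' hinf hH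
  exact ⟨c, hcCund, hcv, hcK, hsq, hfl, D.gLabAutOfPiCund_eq_chart_conj_negOne CG c hcCund hcU⟩

/-- **Shape-of-record form** (abc-iut-L5-lead RULINGS #36 (4): the bad-place kit binder is a pair `H ≤ H′ ≤ Π_{C̲_K}` with
`[H′ : H] = 2` and `H′ ∩ Π_{X̲_K} = H`): all (β)-inputs at that place, labels included, with `φ^{Θell}_{•,v̲} = (xH ↦ xΠ_{X̲_K})` built
from `H = H′ ∩ Π_{X̲_K} ≤ Π_{X̲_K}`. ([IUTchI] Ex 6.3 (ii) p.161) [claim: Mochizuki2012, status: disputed] -/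
theorem exists_negCompat_bad_labels_of_inf_eq [Fact l.Prime] [(D.PiXund.subgroupOf D.PiXK).Normal]
    {H H' : Subgroup D.PiC} (hle : H ≤ H') (h2 : H.relIndex H' = 2) (hH' : H' ≤ D.PiCund)
    (hinf : H' ⊓ D.PiXund = H) :
    ∃ (c : D.PiC) (hc : c ∈ D.PiCund), c ∈ H' ∧ c ∉ H ∧ c ∉ D.PiXund ∧
      ∃ (hcv : c ∈ Subgroup.normalizer ((H : Subgroup D.PiC) : Set D.PiC))
        (hcK : c ∈ Subgroup.normalizer ((D.PiXund : Subgroup D.PiC) : Set D.PiC)),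
      OrbitCat.autOfNormalizer c hcv ≠ Iso.refl _ ∧
      OrbitCat.autOfNormalizer c hcv ≪≫ OrbitCat.autOfNormalizer c hcv = Iso.refl _ ∧
      (OrbitCat.autOfNormalizer c hcv).hom ≫
            OrbitCat.homOfElem 1 (OrbitCat.one_conj_mem_of_le (D.le_PiXund_of_inf_eq hinf)) =
          OrbitCat.homOfElem 1 (OrbitCat.one_conj_mem_of_le (D.le_PiXund_of_inf_eq hinf)) ≫
            (OrbitCat.autOfNormalizer c hcK).hom ∧
      D.toFlStarGlobal (OrbitCat.autOfNormalizer c hcK) = 1 ∧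
      D.gLabAutOfPiCund CG c hc ((D.gChart₀Model CG).symm 0) = (D.gChart₀Model CG).symm 0 ∧
      (∀ x, D.gChart₀Model CG (D.gLabAutOfPiCund CG c hc x) = -D.gChart₀Model CG x) ∧
      D.gLabAutOfPiCund CG c hc ≠ 1 :=
  D.exists_negCompat_bad_labels CG hle h2 hH' hinf.le (D.le_PiXund_of_inf_eq hinf)

end InitialThetaData

end Bad

end Literature.IUT.HodgeTheaters
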